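import Mathlib.Analysis.Complex.Basic
import Mathlib.Topology.Homotopy.Equiv
import Mathlib.Topology.LocalAtTarget
import Literature.AlgebraicTopology.CharacteristicClasses.TautologicalLineCore
import Literature.AlgebraicTopology.SingularHomology.SingularChains
import HarnessLib

/-!
# Linear deformations of projective space: `{[v] | P v ≠ 0}` retracts onto `ℙ(range P)`

Topic `Literature/AlgebraicTopology/CharacteristicClasses`. For a continuous linear PROJECTION
`P` (`P² = P`) of a complex normed space `V`, the open set `{[v] | P v ≠ 0} ⊆ ℙ ℂ V`
(`projChart P`) deformation retracts, through the projective linear homotopy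
`[v] ↦ [(1 - t) v + t P v]` (`projDeformation`), onto the closed set of lines contained in
`range P` (`rangeLocus P`), which is the homeomorphic image of `ℙ ℂ (range P)` (`rangeLocusHomeomorph`,
`range P` finite-dimensional). Two instances drive the low-dimensional homology of projective
spaces (`ProjectiveSpaceLowHomology`):

* `P = 1 - u ⊗ φ` (`φ u = 1`), the projection onto the hyperplane `W = ker φ` along `u`:
  `{[v] | P v ≠ 0} = ℙ V ∖ {[u]}` retracts onto `ℙ(W)` — the complement of the top cell of
  `ℂPⁿ = ℂPⁿ⁻¹ ∪ e²ⁿ` (A. Hatcher, *Algebraic Topology* (2002), Example 0.6 and the cell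
  structure of `ℂPⁿ`, p. 7: "`ℂPⁿ` is obtained from `ℂPⁿ⁻¹` by attaching a `2n`-cell", whose
  complement of the centre retracts onto `ℂPⁿ⁻¹`);
* `P` the orthogonal projection onto a finite-dimensional subspace `W` of a Hilbert space `H`:
  the sets `{[v] | P_W v ≠ 0}` exhaust `ℙ(H)` and each retracts onto `ℙ(W)` (the passage from
  `ℂPⁿ` to `ℂP^∞`, Hatcher p. 7).

## Content (all proved)

* `projChart P`, `rangeLocus P` (`⊆ projChart P`), openness, membership of `[v]`;
* `deformVec P t v = (1 - t) v + t P v` and `projDeformation P hP : C(projChart P × I, projChart P)`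
  (continuity through the open quotient map `{v | P v ≠ 0} → projChart P`);
* `rangeLocusRetraction`, `rangeLocusHomotopyEquiv : rangeLocus P ≃ₕ projChart P` (inclusion and
  `[v] ↦ [P v]`), hence `isIso_singularHomology_map_rangeLocus_inclusion` (homotopy invariance of
  the tree's singular homology, `singularHomology.isoOfHomotopyEquiv`);
* `rangeLocusHomeomorph : ℙ ℂ (range P) ≃ₜ rangeLocus P` for `range P` finite-dimensional.

## References

* A. Hatcher, *Algebraic Topology*, CUP 2002, Ch. 0 Example 0.6 and p. 7 (cell structure of
  `ℂPⁿ`, `ℂP^∞`), Cor. 2.11 (homotopy invariance). [Hatcher2002]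
-/

noncomputable section

open Function Set Filter Topology unitInterval
open scoped LinearAlgebra.Projectivization

universe u v

namespace Literature.AlgebraicTopology.CharacteristicClasses

variable {V : Type u} [NormedAddCommGroup V] [NormedSpace ℂ V] (P : V →L[ℂ] V)

/-! ### The open set `{P ≠ 0}` and the locus of lines in `range P` -/

/-- For a unit `a`, `P (a • v) ≠ 0 ↔ P v ≠ 0`: non-vanishing of `P` on the chosen representative.
[folklore] -/
theorem apply_rep_mk_ne_zero_iff' (v : V) (hv : v ≠ 0) :
    P (Projectivization.mk ℂ v hv).rep ≠ 0 ↔ P v ≠ 0 := by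
  obtain ⟨a, ha⟩ := Projectivization.exists_smul_eq_mk_rep ℂ v hv
  rw [← ha, Units.smul_def, map_smul]
  exact smul_ne_zero_iff.trans (and_iff_right a.ne_zero)

/-- The open set `{[v] | P v ≠ 0} ⊆ ℙ ℂ V` of lines not killed by `P` (for `P = 1 - u ⊗ φ` this is
the complement of the point `[u]`; for an orthogonal projection onto `W`, the lines not
orthogonal to `W`). [cite: Hatcher2002, Ch. 0 p. 7] -/
def projChart : Set (ℙ ℂ V) := {p | P p.rep ≠ 0}

/-- `[v] ∈ projChart P ↔ P v ≠ 0`. [folklore] -/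
@[simp]
theorem mk_mem_projChart_iff (v : V) (hv : v ≠ 0) :
    Projectivization.mk ℂ v hv ∈ projChart P ↔ P v ≠ 0 :=
  apply_rep_mk_ne_zero_iff' P v hv

/-- `projChart P` is open. [folklore] -/
theorem isOpen_projChart : IsOpen (projChart P) := by
  rw [← Projectivization.isQuotientMap_mk.isCoinducing.isOpen_preimage]
  have : (fun v : {v : V // v ≠ 0} ↦ Projectivization.mk ℂ v.1 v.2) ⁻¹' projChart P =
      {v : {v : V // v ≠ 0} | P v ≠ 0} := Set.ext fun v ↦ mk_mem_projChart_iff P v v.2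
  rw [this]
  exact isOpen_ne_fun (P.continuous.comp continuous_subtype_val) continuous_const

/-- The closed set of lines contained in `range P`, `{[v] | P v = v}` (for `P = 1 - u ⊗ φ`:
`ℙ(ker φ)`; for the orthogonal projection onto `W`: `ℙ(W)`). [cite: Hatcher2002, Ch. 0 p. 7] -/
def rangeLocus : Set (ℙ ℂ V) := {p | P p.rep = p.rep}

/-- `[v] ∈ rangeLocus P ↔ P v = v`. [folklore] -/
@[simp]
theorem mk_mem_rangeLocus_iff (v : V) (hv : v ≠ 0) :
    Projectivization.mk ℂ v hv ∈ rangeLocus P ↔ P v = v := by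
  obtain ⟨a, ha⟩ := Projectivization.exists_smul_eq_mk_rep ℂ v hv
  change P (Projectivization.mk ℂ v hv).rep = (Projectivization.mk ℂ v hv).rep ↔ _
  rw [← ha, Units.smul_def, map_smul]
  exact smul_right_injective V a.ne_zero |>.eq_iff

/-- Lines in `range P` are not killed by `P`. [folklore] -/
theorem rangeLocus_subset_projChart : rangeLocus P ⊆ projChart P := by
  intro p hp
  change P p.rep ≠ 0
  rw [show P p.rep = p.rep from hp]
  exact p.rep_nonzero

/-! ### The linear deformation `v ↦ (1 - t) v + t P v` -/

/-- The linear homotopy from the identity to `P`: `(1 - t) v + t P v`. [cite: Hatcher2002, Ch. 0 Example 0.6] -/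
def deformVec (t : ℝ) (v : V) : V := ((1 - t : ℝ) : ℂ) • v + ((t : ℝ) : ℂ) • P v

/-- `deformVec` is jointly continuous. [folklore] -/
theorem continuous_deformVec : Continuous fun q : ℝ × V ↦ deformVec P q.1 q.2 := by
  unfold deformVec
  fun_prop

/-- For a projection, `P` is unchanged along the deformation: `P((1-t)v + tPv) = P v`. [folklore] -/
theorem apply_deformVec (hP : ∀ v, P (P v) = P v) (t : ℝ) (v : V) : P (deformVec P t v) = P v := by
  rw [deformVec, map_add, map_smul, map_smul, hP, ← add_smul, ← Complex.ofReal_add, sub_add_cancel,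
    Complex.ofReal_one, one_smul]

/-- The deformation of a vector with `P v ≠ 0` never vanishes. [folklore] -/
theorem deformVec_ne_zero (hP : ∀ v, P (P v) = P v) {v : V} (hv : P v ≠ 0) (t : ℝ) :
    deformVec P t v ≠ 0 := fun h ↦ hv (by rw [← apply_deformVec P hP t v, h, map_zero])

/-- The deformation is homogeneous: `deformVec (c • v) = c • deformVec v`. [folklore] -/
theorem deformVec_smul (t : ℝ) (c : ℂ) (v : V) : deformVec P t (c • v) = c • deformVec P t v := by
  rw [deformVec, deformVec, map_smul, smul_comm _ c v, smul_comm _ c (P v), smul_add]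

/-- At time `0` the deformation is the identity. [folklore] -/
@[simp]
theorem deformVec_zero (v : V) : deformVec P 0 v = v := by
  simp [deformVec]

/-- At time `1` the deformation is `P`. [folklore] -/
@[simp]
theorem deformVec_one (v : V) : deformVec P 1 v = P v := by
  simp [deformVec]

/-- Vectors of `range P` do not move. [folklore] -/
theorem deformVec_of_apply_eq (t : ℝ) {v : V} (hv : P v = v) : deformVec P t v = v := by
  rw [deformVec, hv, ← add_smul, ← Complex.ofReal_add, sub_add_cancel, Complex.ofReal_one, one_smul]

/-! ### The deformation of `projChart P` onto `rangeLocus P` -/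

/-- **The projective linear deformation** `([v], t) ↦ [(1 - t) v + t P v]` of the open set
`{[v] | P v ≠ 0}`, a continuous map `projChart P × I → projChart P` (well defined by homogeneity;
computed on the chosen representatives). At `t = 0` the identity, at `t = 1` the retraction
`[v] ↦ [P v]` onto `rangeLocus P`, which stays fixed (Hatcher 2002, Ch. 0, Example 0.6 and p. 7).
[cite: Hatcher2002, Ch. 0 Example 0.6] -/
def projDeformation (hP : ∀ v, P (P v) = P v) : C(↥(projChart P) × I, ↥(projChart P)) where
  toFun q := ⟨Projectivization.mk ℂ (deformVec P q.2 q.1.1.rep)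
      (deformVec_ne_zero P hP q.1.2 q.2),
    (mk_mem_projChart_iff P _ _).2 (by rw [apply_deformVec P hP]; exact q.1.2)⟩
  continuous_toFun := by
    -- the open quotient map `{v | P v ≠ 0} → projChart P`, `v ↦ [v]`
    set mk₀ : {v : V // v ≠ 0} → ℙ ℂ V := fun v ↦ Projectivization.mk ℂ v.1 v.2 with hmk₀
    have hq : IsOpenQuotientMap ((projChart P).restrictPreimage mk₀) :=
      Projectivization.isOpenQuotientMap_mk.restrictPreimage _
    have hqI := hq.prodMap (IsOpenQuotientMap.id (X := I))
    refine (hqI.continuous_comp_iff).1 ?_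
    -- upstairs the map is `(v, t) ↦ [deformVec t v]`
    have hne : ∀ q : ↥(mk₀ ⁻¹' projChart P) × I, deformVec P q.2 q.1.1.1 ≠ 0 := fun q ↦
      deformVec_ne_zero P hP ((mk_mem_projChart_iff P _ q.1.1.2).1 q.1.2) q.2
    have h1 : Continuous fun q : ↥(mk₀ ⁻¹' projChart P) × I ↦ ((q.2 : ℝ), (q.1.1.1 : V)) := by
      fun_prop
    have hcont' : Continuous fun q : ↥(mk₀ ⁻¹' projChart P) × I ↦
        Projectivization.mk ℂ (deformVec P q.2 q.1.1.1) (hne q) :=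
      ((continuous_deformVec P).comp h1).projectivizationMk hne
    have hcont : Continuous fun q : ↥(mk₀ ⁻¹' projChart P) × I ↦
        (⟨Projectivization.mk ℂ (deformVec P q.2 q.1.1.1) (hne q),
          (mk_mem_projChart_iff P _ _).2 (by
            rw [apply_deformVec P hP]
            exact (mk_mem_projChart_iff P _ q.1.1.2).1 q.1.2)⟩ : ↥(projChart P)) :=
      hcont'.subtype_mk _
    convert hcont using 1
    funext q
    apply Subtype.ext
    change Projectivization.mk ℂ (deformVec P q.2 (Projectivization.mk ℂ q.1.1.1 q.1.1.2).rep) _ =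
      Projectivization.mk ℂ (deformVec P q.2 q.1.1.1) _
    obtain ⟨a, ha⟩ := Projectivization.exists_smul_eq_mk_rep ℂ q.1.1.1 q.1.1.2
    simp_rw [← ha, Units.smul_def, deformVec_smul]
    exact (Projectivization.mk_eq_mk_iff ℂ _ _ _ _).2 ⟨a, rfl⟩

/-- The deformation on a class `[v]`: `[(1 - t) v + t P v]`. [folklore] -/
theorem projDeformation_apply_mk (hP : ∀ v, P (P v) = P v) {v : V} (hv : v ≠ 0)
    (hPv : Projectivization.mk ℂ v hv ∈ projChart P) (t : I) :
    (projDeformation P hP (⟨Projectivization.mk ℂ v hv, hPv⟩, t) : ℙ ℂ V) =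
      Projectivization.mk ℂ (deformVec P t v)
        (deformVec_ne_zero P hP ((mk_mem_projChart_iff P v hv).1 hPv) t) := by
  change Projectivization.mk ℂ (deformVec P t (Projectivization.mk ℂ v hv).rep) _ = _
  obtain ⟨a, ha⟩ := Projectivization.exists_smul_eq_mk_rep ℂ v hv
  simp_rw [← ha, Units.smul_def, deformVec_smul]
  exact (Projectivization.mk_eq_mk_iff ℂ _ _ _ _).2 ⟨a, rfl⟩

/-- At `t = 0` the deformation is the identity. [folklore] -/
theorem projDeformation_zero (hP : ∀ v, P (P v) = P v) (p : ↥(projChart P)) :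
    projDeformation P hP (p, 0) = p := by
  apply Subtype.ext
  change Projectivization.mk ℂ (deformVec P (0 : I) p.1.rep) _ = p.1
  simp_rw [show ((0 : I) : ℝ) = 0 from rfl, deformVec_zero]
  exact p.1.mk_rep

/-- At `t = 1` the deformation lands in `rangeLocus P` (`[v] ↦ [P v]`). [folklore] -/
theorem projDeformation_one_mem (hP : ∀ v, P (P v) = P v) (p : ↥(projChart P)) :
    (projDeformation P hP (p, 1) : ℙ ℂ V) ∈ rangeLocus P := by
  change Projectivization.mk ℂ (deformVec P (1 : I) p.1.rep) _ ∈ rangeLocus P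
  simp_rw [show ((1 : I) : ℝ) = 1 from rfl, deformVec_one]
  rw [mk_mem_rangeLocus_iff]
  exact hP _

/-- The deformation fixes `rangeLocus P` pointwise. [folklore] -/
theorem projDeformation_of_mem_rangeLocus (hP : ∀ v, P (P v) = P v) (p : ↥(projChart P))
    (hp : (p : ℙ ℂ V) ∈ rangeLocus P) (t : I) : projDeformation P hP (p, t) = p := by
  apply Subtype.ext
  change Projectivization.mk ℂ (deformVec P t p.1.rep) _ = p.1
  simp_rw [deformVec_of_apply_eq P t (show P p.1.rep = p.1.rep from hp)]
  exact p.1.mk_rep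

/-- **The retraction `[v] ↦ [P v]`** of `projChart P` onto `rangeLocus P` (end of the
deformation). [cite: Hatcher2002, Ch. 0 Example 0.6] -/
def rangeLocusRetraction (hP : ∀ v, P (P v) = P v) : C(↥(projChart P), ↥(rangeLocus P)) where
  toFun p := ⟨(projDeformation P hP (p, 1) : ℙ ℂ V), projDeformation_one_mem P hP p⟩
  continuous_toFun := (continuous_subtype_val.comp
    ((projDeformation P hP).continuous.comp (continuous_id.prodMk continuous_const))).subtype_mk _

/-- The inclusion `rangeLocus P ⊆ projChart P` as a continuous map. [folklore] -/
abbrev rangeLocusInclusion : C(↥(rangeLocus P), ↥(projChart P)) :=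
  ⟨Set.inclusion (rangeLocus_subset_projChart P), continuous_inclusion _⟩

/-- The retraction is a left inverse of the inclusion. [folklore] -/
theorem rangeLocusRetraction_comp_inclusion (hP : ∀ v, P (P v) = P v) :
    (rangeLocusRetraction P hP).comp (rangeLocusInclusion P) = ContinuousMap.id _ := by
  ext p : 1
  apply Subtype.ext
  change (projDeformation P hP (⟨p.1, rangeLocus_subset_projChart P p.2⟩, 1) : ℙ ℂ V) = p.1
  rw [projDeformation_of_mem_rangeLocus P hP _ p.2]

/-- The homotopy from `inclusion ∘ retraction` to the identity of `projChart P` (the deformation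
run backwards). [cite: Hatcher2002, Ch. 0 Example 0.6] -/
def rangeLocusHomotopy (hP : ∀ v, P (P v) = P v) :
    ContinuousMap.Homotopy ((rangeLocusInclusion P).comp (rangeLocusRetraction P hP))
      (ContinuousMap.id ↥(projChart P)) where
  toFun q := projDeformation P hP (q.2, σ q.1)
  continuous_toFun := (projDeformation P hP).continuous.comp
    (continuous_snd.prodMk (continuous_symm.comp continuous_fst))
  map_zero_left p := by
    change projDeformation P hP (p, σ 0) = _
    rw [symm_zero]
    rfl
  map_one_left p := by
    change projDeformation P hP (p, σ 1) = p
    rw [symm_one, projDeformation_zero]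

/-- **`rangeLocus P` is a deformation retract of `projChart P`**: the inclusion is a homotopy
equivalence with homotopy inverse `[v] ↦ [P v]` (Hatcher 2002, Ch. 0 Example 0.6 / p. 7: the
complement of the top cell of `ℂPⁿ` retracts onto `ℂPⁿ⁻¹`). [cite: Hatcher2002, Ch. 0 Example 0.6] -/
def rangeLocusHomotopyEquiv (hP : ∀ v, P (P v) = P v) :
    ContinuousMap.HomotopyEquiv ↥(rangeLocus P) ↥(projChart P) where
  toFun := rangeLocusInclusion P
  invFun := rangeLocusRetraction P hP
  left_inv := by rw [rangeLocusRetraction_comp_inclusion]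
  right_inv := ⟨rangeLocusHomotopy P hP⟩

/-- **The inclusion `rangeLocus P ↪ projChart P` induces isomorphisms on singular homology**
(it is a homotopy equivalence; Hatcher 2002, Cor. 2.11). [cite: Hatcher2002, Cor. 2.11] -/
theorem isIso_singularHomology_map_rangeLocusInclusion (R M : Type v) [CommRing R]
    [AddCommGroup M] [Module R M] (hP : ∀ v, P (P v) = P v) (n : ℕ) :
    CategoryTheory.IsIso (Literature.AlgebraicTopology.SingularHomology.singularHomology.map R M
      (rangeLocusInclusion P) n) := by
  change CategoryTheory.IsIso
    (Literature.AlgebraicTopology.SingularHomology.singularHomology.isoOfHomotopyEquiv R M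
      (rangeLocusHomotopyEquiv P hP) n).hom
  infer_instance

/-! ### `rangeLocus P` is `ℙ(range P)` -/

/-- The inclusion `ℙ(range P) → ℙ V` induced by the inclusion of the subspace `range P`.
[folklore] -/
def rangeProjectivizationMap : ℙ ℂ ↥(LinearMap.range (P : V →ₗ[ℂ] V)) → ℙ ℂ V :=
  Projectivization.map (LinearMap.range (P : V →ₗ[ℂ] V)).subtype (Submodule.injective_subtype _)

/-- The inclusion `ℙ(range P) → ℙ V` is continuous. [folklore] -/
theorem continuous_rangeProjectivizationMap : Continuous (rangeProjectivizationMap P) :=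
  continuous_map _ (Submodule.injective_subtype _) (by exact continuous_subtype_val)

/-- The inclusion `ℙ(range P) → ℙ V` is injective. [folklore] -/
theorem injective_rangeProjectivizationMap : Injective (rangeProjectivizationMap P) :=
  Projectivization.map_injective _ (Submodule.injective_subtype _)

/-- The image of `ℙ(range P) → ℙ V` is `rangeLocus P` (for a projection `P`). [folklore] -/
theorem range_rangeProjectivizationMap (hP : ∀ v, P (P v) = P v) :
    Set.range (rangeProjectivizationMap P) = rangeLocus P := by
  ext p
  constructor
  · rintro ⟨q, rfl⟩
    induction q with
    | h w hw =>
      rw [rangeProjectivizationMap, Projectivization.map_mk, mk_mem_rangeLocus_iff]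
      obtain ⟨v, hv⟩ := w.2
      change P (w : V) = w
      rw [← hv]
      exact hP v
  · intro hp
    induction p with
    | h v hv =>
      have hPv : P v = v := (mk_mem_rangeLocus_iff P v hv).1 hp
      refine ⟨Projectivization.mk ℂ ⟨v, ⟨v, hPv⟩⟩ (fun h ↦ hv (congrArg Subtype.val h)), ?_⟩
      rw [rangeProjectivizationMap, Projectivization.map_mk]
      rfl

/-- **`ℙ(range P) ≅ rangeLocus P`** for a projection `P` with finite-dimensional range: the
continuous injection `ℙ(range P) → ℙ V` from a compact space to a Hausdorff space is a
homeomorphism onto its image `rangeLocus P`. [folklore] -/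
def rangeLocusHomeomorph (hP : ∀ v, P (P v) = P v) [FiniteDimensional ℂ ↥(LinearMap.range (P : V →ₗ[ℂ] V))] :
    ℙ ℂ ↥(LinearMap.range (P : V →ₗ[ℂ] V)) ≃ₜ ↥(rangeLocus P) :=
  haveI : CompactSpace (ℙ ℂ ↥(LinearMap.range (P : V →ₗ[ℂ] V))) := compactSpace_of_finiteDimensional ℂ _
  (((continuous_rangeProjectivizationMap P).isClosedEmbedding
    (injective_rangeProjectivizationMap P)).isEmbedding.toHomeomorph).trans
    (Homeomorph.setCongr (range_rangeProjectivizationMap P hP))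

/-- The homeomorphism `ℙ(range P) ≅ rangeLocus P` is the inclusion on points. [folklore] -/
@[simp]
theorem coe_rangeLocusHomeomorph (hP : ∀ v, P (P v) = P v)
    [FiniteDimensional ℂ ↥(LinearMap.range (P : V →ₗ[ℂ] V))] (q : ℙ ℂ ↥(LinearMap.range (P : V →ₗ[ℂ] V))) :
    (rangeLocusHomeomorph P hP q : ℙ ℂ V) = rangeProjectivizationMap P q := rfl

end Literature.AlgebraicTopology.CharacteristicClasses
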